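import Summits.BirchSwinnertonDyer.BirchSwinnertonDyer.Theorems.CyclotomicUntwistAmiceInjective
import Summits.BirchSwinnertonDyer.BirchSwinnertonDyer.Theorems.CyclotomicUntwistFiniteSlopeValueAtOne
import Summits.BirchSwinnertonDyer.BirchSwinnertonDyer.Theorems.CyclotomicUntwistGammaDivisibility
import HarnessLib

/-!
# On a rank-one Pollack–Stevens row the typed `3`-adic `L`-function has a zero of FINITE POSITIVE order
# at `𝟙`: `𝓛(T) = T^r · u(T)`, `1 ≤ r < ∞`, `u(0) = lead_𝟙(𝓛) ≠ 0` — unconditionally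

Cell `pub/bsd-wall` (D-0145 line `route-BirchSwinnertonDyer-CyclotomicUntwist`), seat `bsd-line-cycu-p1`
(prover seat 1/3), helper toward crux K1 `PSRankOneLowerHalfAtThree` (stmt-BirchSwinnertonDyer-21580;
mirror use K2, 21581), D1/D3 currency.  Assembly of `CyclotomicUntwistAmiceInjective`
(`gammaAmiceTransform ≠ 0`, this seat) with `CyclotomicUntwistFiniteSlopeValueAtOne` (`𝓛(𝟙) = 9η(−1)α⁻²[0]⁺_f`,
vanishing at `𝟙` in analytic rank `1`, this seat's earlier generation).  THEOREMS ONLY (no definition, no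
named fact, no `sorry`); BSD is not proved by this file and no crux is: the cruxes ask `r = 1` (with the
leading term identified), here only `1 ≤ r < ⊤` is proved.

* `factorisation_of_ne_zero` (general `p`): non-zero additive ball values of order `< 1` have
  `L_μ(T) = T^{ord} · u(T)` with `u(0) = gammaLeadingCoeff p μ ≠ 0` (Mathlib `X_pow_order_mul_divXPowOrder`).
* `orderAtOne_of_analyticRank_eq_one` — for `W` additive at `3` of analytic rank `1`, `η` primitive mod `9`,
  `α ≠ 0` and `IsPSCyclotomicLFunctionOf W η α 𝓛`: **there is `r : ℕ` with `1 ≤ r`,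
  `gammaOrderAtOne 3 𝓛 = r`, `gammaLeadingCoeff 3 𝓛 ≠ 0` and `gammaAmiceTransform 3 𝓛 = T^r · u`,
  `u(0) = gammaLeadingCoeff 3 𝓛`** — the order of vanishing at the trivial character is an honest positive
  integer (lower bound: `L(W,1) = 0`, `CyclotomicUntwistValueAtOne.vanishing_at_one_of_analyticRank_eq_one`;
  finiteness: Amice injectivity + cycu-p5's non-zero ball value); `orderAtOne_of_entireLFunction_one_eq_zero` —
  the same from `L(W,1) = 0`; `orderAtOne_eq_zero_of_entireLFunction_one_ne_zero` — in analytic rank `0`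
  the order is `0` and `lead_𝟙 = 𝓛(𝟙) ≠ 0` (no exceptional zero).

References: [cite: MazurTateTeitelbaum1986Invent, §I.13 and §I.14]; [cite: Bellaiche2021, Thm. 6.2.13, Thm. 6.7.9].
-/

noncomputable section

open scoped MatrixGroups

open Filter Topology Literature.NumberTheory.IwasawaTheory
  Literature.NumberTheory.EllipticCurves Literature.NumberTheory.EllipticCurves.Rank1Residual
  Summit.BirchSwinnertonDyer.BirchSwinnertonDyer.Theorems.PSAmiceInjective
  Summit.BirchSwinnertonDyer.BirchSwinnertonDyer.Theorems.CyclotomicUntwistValueAtOne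
  Summit.BirchSwinnertonDyer.BirchSwinnertonDyer.Theorems.PSGammaDivisibility

-- single-conjunct summit: `Summit.BirchSwinnertonDyer.BirchSwinnertonDyer.…` repeats the name by design
set_option linter.dupNamespace false
set_option autoImplicit false

namespace Summit.BirchSwinnertonDyer.BirchSwinnertonDyer.Theorems.PSAmiceRankOne

variable {p : ℕ} [hp : Fact p.Prime]

/-! ### §1 The Weierstrass-type factorisation `L_μ = T^{ord} · u`, `u(0) ≠ 0` -/

/-- **`L_μ(T) = T^{ord_𝟙} · u(T)` with `u(0) = lead_𝟙(μ) ≠ 0`** for non-zero additive ball values of order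
`< 1` (`u = divXPowOrder L_μ`; `ord_𝟙 = gammaOrderAtOne`, `lead_𝟙 = gammaLeadingCoeff` of D3).
[cite: MazurTateTeitelbaum1986Invent, §I.13] [cite: Bellaiche2021, Thm. 6.2.13] -/
theorem factorisation_of_ne_zero {μ : (n : ℕ) → ZMod (p ^ n) → ℂ_[p]} (hμ : IsGammaDistribution p μ)
    {ν : ℝ} (hν : HasGrowthOrder p ν μ) (hν1 : ν < 1) (h : ∃ (n : ℕ) (s : ZMod (p ^ n)), μ n s ≠ 0) :
    ∃ r : ℕ, gammaOrderAtOne p μ = r ∧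
      gammaAmiceTransform p μ =
        PowerSeries.X ^ r * PowerSeries.divXPowOrder (gammaAmiceTransform p μ) ∧
      PowerSeries.constantCoeff (PowerSeries.divXPowOrder (gammaAmiceTransform p μ)) =
        gammaLeadingCoeff p μ ∧
      gammaLeadingCoeff p μ ≠ 0 := by
  have hlt := gammaOrderAtOne_lt_top hμ hν hν1 h
  refine ⟨(gammaOrderAtOne p μ).toNat, (ENat.coe_toNat (ne_top_of_lt hlt)).symm, ?_,
    (gammaLeadingCoeff_eq_constantCoeff_divXPowOrder μ).symm, gammaLeadingCoeff_ne_zero hμ hν hν1 h⟩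
  rw [gammaOrderAtOne_def, PowerSeries.X_pow_order_mul_divXPowOrder]

/-! ### §2 Rank-one Pollack–Stevens rows -/

section Curve

variable {W : WeierstrassCurve ℚ} [W.IsElliptic] {η : DirichletCharacter ℂ_[3] (3 ^ 2)} {α : ℂ_[3]}
  {𝓛 : (n : ℕ) → ZMod (3 ^ n) → ℂ_[3]}

/-- **`L(W,1) = 0` ⇒ the typed `3`-adic `L`-function vanishes at `𝟙` to FINITE POSITIVE order.** For `W`
additive at `3`, `η` primitive mod `9`, `α ≠ 0`, `IsPSCyclotomicLFunctionOf W η α 𝓛` and `L(W, 1) = 0`: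
`∃ r ≥ 1`, `gammaOrderAtOne 3 𝓛 = r`, `gammaAmiceTransform 3 𝓛 = T^r · u` with `u(0) = gammaLeadingCoeff 3 𝓛 ≠ 0`.
[cite: MazurTateTeitelbaum1986Invent, §I.13 and §I.14] -/
theorem orderAtOne_of_entireLFunction_one_eq_zero (h : IsPSCyclotomicLFunctionOf W η α 𝓛)
    (hadd : Addv W 3) (hη : η.IsPrimitive) (hα : α ≠ 0) (hL : W.entireLFunction 1 = 0) :
    ∃ r : ℕ, 1 ≤ r ∧ gammaOrderAtOne 3 𝓛 = r ∧
      gammaAmiceTransform 3 𝓛 =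
        PowerSeries.X ^ r * PowerSeries.divXPowOrder (gammaAmiceTransform 3 𝓛) ∧
      PowerSeries.constantCoeff (PowerSeries.divXPowOrder (gammaAmiceTransform 3 𝓛)) =
        gammaLeadingCoeff 3 𝓛 ∧
      gammaLeadingCoeff 3 𝓛 ≠ 0 := by
  obtain ⟨hdist, hgr⟩ := h.isGammaDistribution_and_hasGrowthOrder
  obtain ⟨r, hr, hfac, hu, hne⟩ := factorisation_of_ne_zero hdist hgr (by norm_num)
    (PSUntwistNonvanishingUnconditional.exists_apply_ne_zero_of_isPSCyclotomicLFunctionOf' h hη hα)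
  obtain ⟨-, -, -, hord⟩ := vanishing_at_one η α 𝓛 h hadd hη hL
  refine ⟨r, ?_, hr, hfac, hu, hne⟩
  rw [hr] at hord
  exact_mod_cast hord

/-- **Analytic rank one ⇒ `1 ≤ ord_𝟙(𝓛^η_W) < ∞` with non-zero leading coefficient** — the rows of the cruxes
K1/K2 (`W.analyticRank = 1`): the typed object has an honest positive order of vanishing at the trivial
character, unconditionally (the cruxes then ask `r = 1` and identify the leading term; not proved here).
[cite: MazurTateTeitelbaum1986Invent, §I.13 and §I.14] -/
theorem orderAtOne_of_analyticRank_eq_one (h : IsPSCyclotomicLFunctionOf W η α 𝓛) (hadd : Addv W 3)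
    (hη : η.IsPrimitive) (hα : α ≠ 0) (hr : W.analyticRank = 1) :
    ∃ r : ℕ, 1 ≤ r ∧ gammaOrderAtOne 3 𝓛 = r ∧
      gammaAmiceTransform 3 𝓛 =
        PowerSeries.X ^ r * PowerSeries.divXPowOrder (gammaAmiceTransform 3 𝓛) ∧
      PowerSeries.constantCoeff (PowerSeries.divXPowOrder (gammaAmiceTransform 3 𝓛)) =
        gammaLeadingCoeff 3 𝓛 ∧
      gammaLeadingCoeff 3 𝓛 ≠ 0 :=
  orderAtOne_of_entireLFunction_one_eq_zero h hadd hη hα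
    (entireLFunction_one_eq_zero_of_analyticRank_eq_one hr)

/-- **Analytic rank zero (`L(W,1) ≠ 0`) ⇒ `ord_𝟙 = 0` and `lead_𝟙 = 𝓛(𝟙) = c₀ ≠ 0`** (no exceptional zero on the
principal-series rows; `apply_zero_zero_ne_zero` of `CyclotomicUntwistValueAtOne` plus the identification of
the leading coefficient). [cite: MazurTateTeitelbaum1986Invent, §I.14 (case p ∣ N, a_p ≠ 0)] -/
theorem orderAtOne_eq_zero_of_entireLFunction_one_ne_zero (h : IsPSCyclotomicLFunctionOf W η α 𝓛)
    (hadd : Addv W 3) (hη : η.IsPrimitive) (hα : α ≠ 0) (hL : W.entireLFunction 1 ≠ 0) :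
    gammaOrderAtOne 3 𝓛 = 0 ∧ gammaLeadingCoeff 3 𝓛 = 𝓛 0 0 ∧ 𝓛 0 0 ≠ 0 := by
  obtain ⟨hne, hord⟩ := apply_zero_zero_ne_zero η α 𝓛 h hadd hη hα hL
  refine ⟨hord, ?_, hne⟩
  rw [gammaLeadingCoeff_def, hord, ← gammaMahlerCoeff_zero h.isGammaDistribution_and_hasGrowthOrder.1]
  simp

end Curve

end Summit.BirchSwinnertonDyer.BirchSwinnertonDyer.Theorems.PSAmiceRankOne

end
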